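import Literature.NumberTheory.IwasawaTheory.Fukuda1994Thm1RankPackage
import Literature.NumberTheory.IwasawaTheory.FukudaGroupLayers
import Literature.NumberTheory.IwasawaTheory.FukudaSmallRankAlgebra
import Literature.NumberTheory.IwasawaTheory.ClassicalMuVanishesIffBoundedRank
import HarnessLib

/-!
# A ONE-LAYER criterion for bounded `p`-ranks and `μ = 0`: `rank_p Cl(K_{n+j}) < p^j - 1` at a single layer `n + j`
# (`n ≥` Fukuda's index) forces `rank_p Cl(K_{n+k}) ≤ rank_p Cl(K_{n+j})` for EVERY `k` (proved, finite level)

`Proofs`-style file (theorems only: no definition, no named fact, no `sorry`) in topic `NumberTheory/IwasawaTheory`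
(namespace = path), written by the literature seat `bsd-potss-conjA-anchor` g20 (cell `bsd-potss`; serves the asides
stmt-BirchSwinnertonDyer-19386 / 19413 and the `μ`-roads of the record lanes k9-c4 / k8t-c4; closes nothing; no class group is computed here).

THE THEOREM (`classGroupPRank_le_of_lt_pow_sub_one`).  `K` a number field, `p` a prime, `κ` a `ℤ_p`-extension of `K` totally
ramified at every ramified prime from layer `n₀` (`TotallyRamifiedFrom κ n₀`), `n ≥ n₀`.  IF `rank_p Cl(K_{n+j}) < p^j - 1` for ONE
`j`, THEN `rank_p Cl(K_{n+k}) ≤ rank_p Cl(K_{n+j})` for EVERY `k ≥ 0` (`classGroupPRank` of the layers).  Consequently the `p`-ranks along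
the tower are bounded (`exists_forall_classGroupPRank_le_of_lt_pow_sub_one`) and Iwasawa's `μ`-invariant vanishes
(`classicalMuVanishes_of_lt_pow_sub_one`, via the cell's finite-level «bounded ranks ⟹ `μ = 0`»,
`classicalMuVanishes_of_forall_classGroupPRank_le`).  Smallest cases: `p = 3`, `n = n₀ = 0`, `j = 1`: **`rank₃ Cl(K₁) ≤ 1 ⟹` all
`rank₃ Cl(K_m) ≤ 1` and `μ = 0`**; `j = 2`: `rank₃ Cl(K₂) ≤ 7` suffices; `p = 5`, `j = 1`: `rank₅ Cl(K₁) ≤ 3`.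

WHY (Washington §13.3 in one line: if `μ > 0` then `X/pX` has a free `𝔽_p⟦T⟧`-summand and `rank_p A_{n+j} ≥ p^j - 1`).  At finite level:
the cell's package `exists_layer_package` (`G = Gal(H_p(K_{n+t})/K_n)`, `A = Gal(H_p/K_{n+t})`, `φ` = conjugation by a totally ramified
inertia generator `g`, `Y₀ = N₀ ∩ A`) gives `p^{rank_p Cl(K_{n+k})} = [G_k : N_k P_k] = #(A/(ν_k Y₀ + pA))` for all `k ≤ t`
(`FukudaGroup.relIndex_commutator_sup_layer_pow_mul_card`, Washington Lemma 13.18 mod `p`); the small-rank lemma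
(`FukudaSmallRank.map_geom_sum_le_of_card_quotient_lt`: on `A/pA`, `ν_j = T^{p^j - 1}` with `T = φ - 1` nilpotent, and
`dim Ā/T^cĀ ≥ c` unless `T^c = 0`) turns `#(A/(ν_j Y₀ + pA)) < p^{p^j-1}` into `ν_j Y₀ ⊆ pA`, whence
`#(A/(ν_k Y₀ + pA)) ≤ #(A/pA) = #(A/(ν_j Y₀ + pA))` for every `k ≤ t`; `t` is arbitrary.

COMPARISON.  Fukuda's Thm. 1 (2) (tree `fukuda1994_thm1_classGroupPRank_const_of_succ_eq_holds`) needs TWO consecutive layers with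
EQUAL ranks; this criterion needs ONE layer with SMALL rank and tolerates growth below it (e.g. `rank₃`: `0 → 1` at layers `0 → 1`
is conclusive here, inconclusive for Fukuda).  Neither implies the other.  Not found in print in this form; the ingredients are
Washington's Lemma 13.18 / Prop. 13.22–13.23 and Fukuda's finite-level method, cited at each use (D-0014: our proof of a statement
assembled from cited ingredients).

References: [Washington1997] L. Washington, *Introduction to Cyclotomic Fields*, 2nd ed., §13.3 Lemmas 13.15, 13.18, Prop. 13.22,
13.23; [Fukuda1994] T. Fukuda, *Remarks on ℤ_p-extensions of number fields*, Proc. Japan Acad. 70 A (1994), Thm. 1, p. 264.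
-/

set_option autoImplicit false

noncomputable section

open scoped NumberField IsMulCommutative
open NumberField Field Finset

namespace Literature.NumberTheory.IwasawaTheory

open Literature.NumberTheory.EllipticCurves

variable {K : Type} [Field K] [NumberField K] {p : ℕ} [hp : Fact p.Prime]

/-! ## §1 Inside the package: `r_{n+k} ≤ r_{n+j}` whenever `r_{n+j} < p^j - 1` -/

/-- The finite-level step: in the package of `K_n ⊆ K_{n+t} ⊆ H_p(K_{n+t})` (`t ≥ max(j, k, 1)`), `rank_p Cl(K_{n+j}) < p^j - 1` gives
`rank_p Cl(K_{n+k}) ≤ rank_p Cl(K_{n+j})`. [cite: Washington1997, §13.3 Lemma 13.18 and Prop. 13.22] [cite: Fukuda1994, Thm. 1 (proof, p. 264)] -/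
private theorem layer_small_rank (κ : ZpExtension K p) {n₀ n : ℕ} (hκ : TotallyRamifiedFrom κ n₀) (hn : n₀ ≤ n) {j k t : ℕ}
    (ht : 1 ≤ t) (hj : j ≤ t) (hk : k ≤ t) (hsmall : classGroupPRank κ (n + j) < p ^ j - 1) :
    classGroupPRank κ (n + k) ≤ classGroupPRank κ (n + j) := by
  classical
  have hp1 : 1 < p := hp.out.one_lt
  obtain ⟨G, _instG, _instF, A', hA'n, _instC, g, 𝓘, hgA, hgen, hA'index, h𝓘, hg𝓘, hA'card, hlayer⟩ :=
    exists_layer_package κ hκ hn t ht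
  obtain ⟨Gj, hAGj, hGj, -, hrj⟩ := hlayer j hj
  obtain ⟨Gk, hAGk, hGk, -, hrk⟩ := hlayer k hk
  -- the data of the small-rank lemma
  set Y : Submodule ℤ (Additive A') := FukudaGroup.subOf A' (⁅(⊤ : Subgroup G), ⊤⁆ ⊔ ⨆ I ∈ 𝓘, I) with hY
  set φ : Module.End ℤ (Additive A') := FukudaGroup.conjEnd A' g with hφ
  set P : Submodule ℤ (Additive A') := (⊤ : Submodule ℤ (Additive A')).map ((p : ℤ) • (1 : Module.End ℤ (Additive A')))
    with hP
  have hφt : φ ^ p ^ t = 1 := FukudaGroup.conjEnd_pow_index_eq_one hgA hgen hA'index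
  -- `#(A/(ν_i Y + pA)) = p^{r_{n+i}}` for `i = j, k`
  have hquot : ∀ {i : ℕ} (hi : i ≤ t) {Gi : Subgroup G} (hAGi : A' ≤ Gi) (hGi : Gi.index = p ^ i),
      ((⁅Gi, Gi⁆ ⊔ ⨆ I ∈ 𝓘, I ⊓ Gi) ⊔ Subgroup.closure ((fun x : G => x ^ p) '' (Gi : Set G))).relIndex Gi =
        Nat.card (Additive A' ⧸ (Y.map (∑ i ∈ range (p ^ i), φ ^ i) ⊔ P)) := by
    intro i hi Gi hAGi hGi
    have hmul := FukudaGroup.relIndex_commutator_sup_layer_pow_mul_card hgA hgen hA'index h𝓘 hg𝓘 hi hAGi hGi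
    have hcard : Nat.card A' = Nat.card ↥(Y.map (∑ i ∈ range (p ^ i), φ ^ i) ⊔ P) *
        Nat.card (Additive A' ⧸ (Y.map (∑ i ∈ range (p ^ i), φ ^ i) ⊔ P)) :=
      Submodule.card_eq_card_quotient_mul_card (Y.map (∑ i ∈ range (p ^ i), φ ^ i) ⊔ P)
    rw [hcard, mul_comm (Nat.card ↥(Y.map _ ⊔ P))] at hmul
    exact Nat.eq_of_mul_eq_mul_right Nat.card_pos hmul
  have hqj := hquot hj hAGj hGj
  have hqk := hquot hk hAGk hGk
  rw [hrj] at hqj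
  rw [hrk] at hqk
  -- the small-rank lemma
  have hlt : Nat.card (Additive A' ⧸ (Y.map (∑ i ∈ range (p ^ j), φ ^ i) ⊔ P)) < p ^ (p ^ j - 1) := by
    rw [← hqj]
    exact Nat.pow_lt_pow_right hp1 hsmall
  have hle := FukudaSmallRank.card_quotient_le_of_card_quotient_lt φ hφt Y j hlt k
  rw [← hqj, ← hqk] at hle
  exact (Nat.pow_le_pow_iff_right hp1).mp hle

/-! ## §2 The criterion along the tower -/

/-- **ONE-LAYER SMALL-RANK CRITERION.**  `κ` a `ℤ_p`-extension of the number field `K`, totally ramified at the ramified primes from layer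
`n₀` (`TotallyRamifiedFrom κ n₀`), `n₀ ≤ n`: if `rank_p Cl(K_{n+j}) < p^j - 1` for some `j`, then `rank_p Cl(K_{n+k}) ≤ rank_p Cl(K_{n+j})` for
every `k`.  (`p = 3`, `n = n₀`, `j = 1`: `rank₃ Cl(K_{n₀+1}) ≤ 1` bounds all later `3`-ranks by it.)
[cite: Washington1997, §13.3 Lemma 13.18 and Prop. 13.22] [cite: Fukuda1994, Thm. 1 (proof, p. 264)] -/
theorem classGroupPRank_le_of_lt_pow_sub_one (κ : ZpExtension K p) {n₀ n : ℕ} (hκ : TotallyRamifiedFrom κ n₀) (hn : n₀ ≤ n)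
    {j : ℕ} (hsmall : classGroupPRank κ (n + j) < p ^ j - 1) (k : ℕ) :
    classGroupPRank κ (n + k) ≤ classGroupPRank κ (n + j) :=
  layer_small_rank κ hκ hn (t := max (max j k) 1) (le_max_right _ _) ((le_max_left _ _).trans (le_max_left _ _))
    ((le_max_right _ _).trans (le_max_left _ _)) hsmall

/-- **Bounded `p`-ranks from one small layer**: under `TotallyRamifiedFrom κ n₀`, `n₀ ≤ n` and `rank_p Cl(K_{n+j}) < p^j - 1`, the
`p`-ranks `rank_p Cl(K_m)` are bounded (by the maximum of the finitely many ranks below layer `n` and `rank_p Cl(K_{n+j})`).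
[cite: Washington1997, §13.3 Prop. 13.23] [cite: Fukuda1994, Thm. 1 (proof, p. 264)] -/
theorem exists_forall_classGroupPRank_le_of_lt_pow_sub_one (κ : ZpExtension K p) {n₀ n : ℕ} (hκ : TotallyRamifiedFrom κ n₀)
    (hn : n₀ ≤ n) {j : ℕ} (hsmall : classGroupPRank κ (n + j) < p ^ j - 1) :
    ∃ B : ℕ, ∀ m, classGroupPRank κ m ≤ B := by
  refine ⟨(range n).sup (classGroupPRank κ) ⊔ classGroupPRank κ (n + j), fun m => ?_⟩
  rcases lt_or_ge m n with hm | hm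
  · exact le_sup_of_le_left (Finset.le_sup (f := classGroupPRank κ) (mem_range.mpr hm))
  · obtain ⟨k, rfl⟩ : ∃ k, m = n + k := ⟨m - n, by omega⟩
    exact le_sup_of_le_right (classGroupPRank_le_of_lt_pow_sub_one κ hκ hn hsmall k)

/-- **`μ = 0` from one small layer**: under `TotallyRamifiedFrom κ n₀`, `n₀ ≤ n` and `rank_p Cl(K_{n+j}) < p^j - 1`, Iwasawa's
`μ`-invariant of `κ` vanishes (growth form `ClassicalMuVanishes`; via the cell's finite-level «bounded ranks ⟹ `μ = 0`»).
[cite: Washington1997, §13.3 Prop. 13.23] [cite: Fukuda1994, Thm. 1 (2), p. 264] -/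
theorem classicalMuVanishes_of_lt_pow_sub_one (κ : ZpExtension K p) {n₀ n : ℕ} (hκ : TotallyRamifiedFrom κ n₀) (hn : n₀ ≤ n)
    {j : ℕ} (hsmall : classGroupPRank κ (n + j) < p ^ j - 1) : ClassicalMuVanishes κ := by
  obtain ⟨B, hB⟩ := exists_forall_classGroupPRank_le_of_lt_pow_sub_one κ hκ hn hsmall
  exact classicalMuVanishes_of_forall_classGroupPRank_le κ hB

/-- **Smallest case (`j = 1`, base layer `n₀`)**: `TotallyRamifiedFrom κ n₀` and `rank_p Cl(K_{n₀+1}) ≤ p - 2` give bounded `p`-ranks —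
`rank_p Cl(K_m) ≤ max_{i ≤ n₀} rank_p Cl(K_i) ⊔ rank_p Cl(K_{n₀+1})` is packaged as `∃ B` — and `μ = 0`.  For `p = 3`: `rank₃ Cl(K_{n₀+1}) ≤ 1`.
[cite: Washington1997, §13.3 Prop. 13.23] [cite: Fukuda1994, Thm. 1 (2), p. 264] -/
theorem classicalMuVanishes_of_classGroupPRank_succ_le (κ : ZpExtension K p) {n₀ : ℕ} (hκ : TotallyRamifiedFrom κ n₀)
    (hsmall : classGroupPRank κ (n₀ + 1) ≤ p - 2) :
    (∃ B : ℕ, ∀ m, classGroupPRank κ m ≤ B) ∧ ClassicalMuVanishes κ := by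
  have hp2 : 2 ≤ p := hp.out.two_le
  have hsmall' : classGroupPRank κ (n₀ + 1) < p ^ 1 - 1 := by rw [pow_one]; omega
  exact ⟨exists_forall_classGroupPRank_le_of_lt_pow_sub_one κ hκ le_rfl hsmall',
    classicalMuVanishes_of_lt_pow_sub_one κ hκ le_rfl hsmall'⟩

end Literature.NumberTheory.IwasawaTheory

end
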